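import Summits.QuantumFields.YangMills.Theorems.F4SubCurvatureDoorGlobalReductionCertificate
import Summits.QuantumFields.YangMills.Theorems.F4SubCurvatureDoorShortRootRigiditySliceInClass
import Summits.QuantumFields.YangMills.Theorems.F4SubCurvatureDoorAngularContinuation
import Summits.QuantumFields.YangMills.Theorems.F4SubCurvatureDoorPeriodicEntireRigidity
import Mathlib
import HarnessLib

/-!
# LINE g21-C «APERTURE BOOTSTRAP» — a proof skeleton for the crux `F4SubCurvatureDoor.ShortRootRigidity` ⟨stmt-QuantumFields-23035⟩

Ideator seat `ym-idea-3`, generation g21 (technique card: positivity / convexity).  This file REFINES the registered LINE g20-A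
`Lines/angular_type.lean` (same crux) at its one remaining XL stub (C) `stub_planarSpectralCone` — stubs (A) `stub_angularContinuation`
(✓ `Theorems/F4SubCurvatureDoorAngularContinuation`) and (P) `stub_periodicEntireRigidity` (✓ `Theorems/F4SubCurvatureDoorPeriodicEntireRigidity`)
have LANDED and are cited BY NAME below; the slice obligations `SliceInClass` ✓p706499, `SliceDensity` ✓p704575 likewise.  (C) is split along
the card's S1–S4 plan (§Hardest stub) into FOUR typed pieces, the local several-complex-variables step being made ELEMENTARY:

* `FlatDoubleEdge` (stub, M, Mathlib-only) — the local Bochner tube theorem for the flat «L-shaped» configuration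
  `{Im l₁(z − p) > 0} ∪ {Im l₂(z − p) > 0}` (two ℂ-independent functionals) WITH THE SUP BOUND and with a gain `δ₁·r` LINEAR in the radius.
  Plan: reduce by an invertible ℂ-linear map, a translation and a dilation to the model `{Im w₁ > 0} ∪ {Im w₂ > 0}` near `0 ∈ ℂ²`, and there use
  the ONE disc family `φ_q(λ) = q + (λ, −λ + icλ²)`: on `|λ| = r` (`cr = 1/8`, `|Im q₁| + |Im q₂| < cr²/4`) one coordinate always has positive
  imaginary part, so `G(q) = (2πi)⁻¹ ∮ f(φ_q(λ)) dλ/λ` is holomorphic near the edge point, `‖G‖ ≤ M`, and `G = f` by the mean-value property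
  (closed disc inside for `Im q₁, Im q₂ > 0`) and the identity theorem.  (Existence without the bound also follows from the tree: named fact
  `Literature.Analysis.Complex.edgeOfTheWedge` with cone `Q₂ = {y₁ < 0 < y₂}` + the PROVED boundary-value theorem
  `Literature.Analysis.Distribution.tendsto_integral_of_norm_le_inv_pow`; the BOUND is what the bootstrap needs.)
* `PlanarInitialAperture` (stub, S from the tree: `planarExponentialMoments` ✓ + pinning as `t → ∞`): some aperture `c > 0` in support form.
* `FlatDoubleEdge → PlanarApertureStep` (stub, L — THE STEP): for `0 < τ < 1`, aperture `τ` ⇒ aperture `τ′ > τ` uniformly in `k, μ`.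
  Plan: the three frame transforms (D₆: the same aperture in the frames at `0, ±60°`) are ONE holomorphic function on the union of the three
  frame tubes `{τ·Re(z·u) > |Im(z·u^⊥)|}` (identity theorem on the convex pairwise intersections through the common real sector); at
  `z⋆(t) = (t, ±iτt)` all three boundaries pass and the conormals `(τ, i)`, `(τ/2 ∓ i√3/2, τ√3/2 ± i/2)` are ℂ-independent iff `τ ≠ 1`
  (`det ∝ τ² − 1`; 4-D analogue kernel-checked in `Cruxes/RationalToGeneral/DiagonalEdgeMinors.lean`); near `z⋆` each tube IS a flat real
  half-space `{Im l_u(z − z⋆) > 0}` inside the ball of radius `τt/2` (the second boundary sheet of each tube stays inactive), so `FlatDoubleEdge`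
  applies with radius `∝ t`.  THE BOUND: the frame majorant `|F_u(w)| ≤ k(s_u(w)·u)`, `s_u = Re(w·u) − |Im(w·u^⊥)|/τ`, degenerates AT the edge
  (all three `s_u(z⋆) = 0`; `k` may blow up at `0`), so one works with the SHIFTED function `G_ε(z) := F(z + εu₀)`: since `u₀·u_± = 1/2 > 0` the
  shift moves every point of all three tubes to margin `s_u ≥ τε/2`, hence `|G_ε| ≤ M_ε := sup_{s ≥ τε/2} k(s, 0) < ∞` on `T₀ ∪ T₊ ∪ T₋`, uniformly
  in `t` — exactly the `ε` of the registered (C).  ⇒ continuation to the ball `|z − z⋆| < δ₁cτt` with bound `M_ε` ⇒ on the line `ζ = t` the function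
  `b ↦ ∫ e^{−(t+ε)E} cos(bp) dμ` is holomorphic on the strip `|Im b| < τ(t + ε)` and on the discs `|b ∓ iτt| < δ₁cτt`, hence on the disc
  `|b| < (τ + δ″)t` for a `δ″ = δ″(τ) > 0` (the caps of that disc outside `|Im b| ≤ (τ − λ)t` lie inside the small discs), with sup `≤ M_ε` there
  ⇒ Lukacs (`Literature.Analysis.Complex.integral_exp_le_of_laplaceFourier_eq_on_ball`, as in S2 ✓) gives `∫ e^{−(t+ε)E} cosh((τ + δ″)t p) dμ ≤ 2M_ε`
  for EVERY `t > 0` ⇒ pinning as `t → ∞` (on `{(τ + δ″)|p| − E ≥ η, E ≤ L}` the integrand is `≥ e^{tη − εL}/2`) kills every such set ⇒ aperture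
  `τ + δ″` in support form.  At `τ = 1` the light cone IS a natural boundary (`K₀(m‖y‖)`): the hypothesis `τ < 1` is sharp, and the three
  conormals become dependent exactly there.
* `PlanarConeSupport → (C)` (stub, S–M): packaging of the support statement into the registered tube form `PlanarSpectralCone`
  (the proof of `Theorems.F4SubCurvatureDoorShortRootRigidityPlanarNarrowTube.planarNarrowTube` with `c = 1` and the cone majorant; the frame
  measure exists by `Theorems.F4SubCurvatureDoorPlanarLaplaceFourier.exists_planarLF` ✓).
The bootstrap itself — «initial aperture + step below slope 1 ⇒ the light cone» — is PROVED here (`planarConeSupport_of_step`: valid apertures are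
closed under limits by continuity of measure, so their supremum is attained, and the step forces it to `1`).  `ShortRootRigidity_of_bootstrap` (PROVED,
the only hypothesis-free theorem of this file concluding the crux) composes the four pieces with the landed (A), (P), the landed slice obligations, the shared
open stub `stub_oddModeRigidity` (verbatim, LINE g19-A's) and the tree certificate `shortRootRigidity_of_global`.
THE SAME ENGINE run on the Gaussian slices in the four A₂-planes is `Cruxes/RationalToGeneral/Lines/forward_cone_rungs.lean`'s `DiagonalGain`
(⟨stmt-QuantumFields-23125⟩, S1): one proof of `FlatDoubleEdge` + `PlanarApertureStep` serves both cruxes.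
HONEST LABEL: a skeleton; (C), the step, stub 4 `OddModeRigidity`, ⟨23035⟩, ⟨23125⟩, R2d and the Yang–Mills mass gap are OPEN; no summit and
no rung is proved by this file; no summit is proved by a line.
-/

noncomputable section

namespace Summit.QuantumFields.YangMills.Cruxes.ShortRootRigidity.ApertureBootstrap

open scoped Topology BigOperators
open Filter Set MeasureTheory
open Literature.MathematicalPhysics.QuantumLattice (timeReflection siteToE)
open Summit.QuantumFields.YangMills.Cruxes.OSLegsAtWeakCouplingC.Sketch (IsSignedPerm)
open Summit.QuantumFields.YangMills.Theorems.F4SubCurvatureDoorMirrorAnalyticityRegistered (E4 InClass)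
open Summit.QuantumFields.YangMills.Theorems.F4SubCurvatureDoorSliceDensityRegistered
  (E2 slice EvenPartSliceInvariant SliceDensity stub_sliceDensity)
open Summit.QuantumFields.YangMills.Theorems.F4SubCurvatureDoorSliceInClassRegistered
  (hexReflection InPlanarClass SliceInClass stub_sliceInClass)
open Summit.QuantumFields.YangMills.Cruxes.ShortRootRigidity.AngularType
  (mk2 polar fwdTube PlanarSpectralConeFrame AngularContinuation PeriodicEntireRigidity
   stub_angularContinuation stub_periodicEntireRigidity)
open Summit.QuantumFields.YangMills.Theses.F4SubCurvatureDoor (ShortRootRigidity)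

/-! ## Vocabulary -/

/-- A planar Laplace–Fourier representing measure of the frame-`0` transform of `k` (the binder shape of the landed
`planarExponentialMoments` / `planarNarrowTube` / `exists_planarLF`, named). [problem-side vocabulary] -/
def IsPlanarLF (k : E2 → ℝ) (μ : Measure (ℝ × ℝ)) : Prop :=
  μ (Set.Iio 0 ×ˢ Set.univ) = 0 ∧
    ∀ t : ℝ, 0 < t → Integrable (fun z : ℝ × ℝ => Real.exp (-(t * z.1))) μ ∧
      ∀ x : ℝ, k (mk2 t x) = ∫ z, Real.exp (-(z.1 * t)) * Real.cos (z.2 * x) ∂μ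

/-- Aperture `τ` in SUPPORT form: no Laplace–Fourier mass strictly below the cone of slope `τ`. [problem-side vocabulary] -/
def HasAperture (μ : Measure (ℝ × ℝ)) (τ : ℝ) : Prop :=
  μ {z : ℝ × ℝ | z.1 < τ * |z.2|} = 0

/-! ## The statements -/

/-- «FLAT DOUBLE EDGE» (M, Mathlib-only): the local Bochner tube theorem for two ℂ-independent flat half-spaces in `ℂ²`, WITH the sup bound
and with gain linear in the radius (`δ₁` depends on `l₁, l₂` only).  Plan: the disc family `φ_q(λ) = q + (λ, −λ + icλ²)` of the module
docstring. [Komatsu, J. Fac. Sci. Univ. Tokyo IA 19 (1972); KatoStruppa2020 Thm 1.4.1; here elementary] [problem-side definition] -/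
def FlatDoubleEdge : Prop :=
  ∀ (l₁ l₂ : (ℂ × ℂ) →L[ℂ] ℂ), LinearIndependent ℂ ![l₁, l₂] →
    ∃ δ₁ : ℝ, 0 < δ₁ ∧ ∀ (p : ℂ × ℂ) (r : ℝ), 0 < r → ∀ (f : ℂ × ℂ → ℂ) (M : ℝ),
      DifferentiableOn ℂ f {z : ℂ × ℂ | ‖z - p‖ < r ∧ (0 < (l₁ (z - p)).im ∨ 0 < (l₂ (z - p)).im)} →
      (∀ z : ℂ × ℂ, ‖z - p‖ < r → (0 < (l₁ (z - p)).im ∨ 0 < (l₂ (z - p)).im) → ‖f z‖ ≤ M) →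
      ∃ g : ℂ × ℂ → ℂ, DifferentiableOn ℂ g (Metric.ball p (δ₁ * r)) ∧ (∀ z ∈ Metric.ball p (δ₁ * r), ‖g z‖ ≤ M) ∧
        ∀ z ∈ Metric.ball p (δ₁ * r), (0 < (l₁ (z - p)).im ∨ 0 < (l₂ (z - p)).im) → g z = f z

/-- «PLANAR INITIAL APERTURE» (S from the tree's `planarExponentialMoments` ✓ and pinning as `t → ∞`). [problem-side definition] -/
def PlanarInitialAperture : Prop :=
  ∀ k : E2 → ℝ, InPlanarClass k → ∃ c : ℝ, 0 < c ∧ ∀ μ : Measure (ℝ × ℝ), IsPlanarLF k μ → HasAperture μ c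

/-- «PLANAR APERTURE STEP» (L — the S3 step): below slope `1` every valid aperture improves, uniformly in `k, μ` (and automatically in `t`).
[problem-side definition] -/
def PlanarApertureStep : Prop :=
  ∀ τ : ℝ, 0 < τ → τ < 1 → ∃ τ' : ℝ, τ < τ' ∧
    ∀ (k : E2 → ℝ) (μ : Measure (ℝ × ℝ)), InPlanarClass k → IsPlanarLF k μ → HasAperture μ τ → HasAperture μ τ'

/-- «PLANAR CONE SUPPORT» (the support form of (C)). [problem-side definition] -/
def PlanarConeSupport : Prop :=
  ∀ (k : E2 → ℝ) (μ : Measure (ℝ × ℝ)), InPlanarClass k → IsPlanarLF k μ → HasAperture μ 1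

/-- (C) of LINE g20-A, verbatim (the landed chart file stores the text as `PlanarSpectralConeFrame`; this is the same constant). -/
abbrev PlanarSpectralCone (k : E2 → ℝ) : Prop := PlanarSpectralConeFrame k

/-- Obligation (2) of LINE g19-A «PLANAR RIGIDITY» (verbatim): every kernel of the planar class is `O(2)`-invariant off `0`.
[problem-side definition] -/
def PlanarRigidity : Prop :=
  ∀ k : E2 → ℝ, InPlanarClass k → ∀ (R : E2 ≃ₗᵢ[ℝ] E2) (y : E2), y ≠ 0 → k (R y) = k y

/-- Obligation (4) of LINE g19-A «ODD-MODE RIGIDITY» (verbatim, shared). [problem-side definition] -/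
def OddModeRigidity : Prop :=
  ∀ K : E4 → ℝ, InClass K → EvenPartSliceInvariant K → ∀ (R : E4 ≃ₗᵢ[ℝ] E4) (x : E4), K (R x) = K x

/-! ## Registered stubs -/

/-- Registered stub «FLAT DOUBLE EDGE» — M, Mathlib-only (disc family of the module docstring). -/
theorem stub_flatDoubleEdge : FlatDoubleEdge := by
  sorry

/-- Registered stub «PLANAR INITIAL APERTURE» — S (tree `planarExponentialMoments` + pinning). -/
theorem stub_planarInitialAperture : PlanarInitialAperture := by
  sorry

/-- Registered stub «PLANAR APERTURE STEP» — L, THE step (three frame tubes as one function, the flat double edge at `(t, ±iτt)`, Lukacs,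
pinning). -/
theorem stub_planarApertureStep : FlatDoubleEdge → PlanarApertureStep := by
  sorry

/-- Registered stub «CONE PACKAGING» — S–M (the proof of `planarNarrowTube` with `c = 1` and the cone majorant; `exists_planarLF` ✓). -/
theorem stub_planarSpectralCone_of_coneSupport :
    PlanarConeSupport → ∀ k : E2 → ℝ, InPlanarClass k → PlanarSpectralCone k := by
  sorry

/-- Registered stub (4) of LINE g19-A «ODD-MODE RIGIDITY» (shared, character-identical). -/
theorem stub_oddModeRigidity : OddModeRigidity := by
  sorry

/-! ## The bootstrap, proved -/

theorem hasAperture_mono {μ : Measure (ℝ × ℝ)} {σ τ : ℝ} (h : HasAperture μ τ) (hστ : σ ≤ τ) : HasAperture μ σ := by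
  refine measure_mono_null (fun z hz => ?_) h
  simp only [Set.mem_setOf_eq] at hz ⊢
  exact lt_of_lt_of_le hz (mul_le_mul_of_nonneg_right hστ (abs_nonneg _))

/-- Apertures are closed under limits (continuity of measure along the union of the strict sub-cones). -/
theorem hasAperture_of_tendsto {μ : Measure (ℝ × ℝ)} {τ : ℕ → ℝ} {τs : ℝ} (h : ∀ n, HasAperture μ (τ n))
    (hlim : Filter.Tendsto τ Filter.atTop (𝓝 τs)) : HasAperture μ τs := by
  have hsub : {z : ℝ × ℝ | z.1 < τs * |z.2|} ⊆ ⋃ n, {z : ℝ × ℝ | z.1 < τ n * |z.2|} := by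
    intro z hz
    simp only [Set.mem_setOf_eq] at hz
    simp only [Set.mem_iUnion, Set.mem_setOf_eq]
    by_cases hp : z.2 = 0
    · exact ⟨0, by simpa [hp] using hz⟩
    · have hpos : 0 < |z.2| := abs_pos.mpr hp
      have hlt : z.1 / |z.2| < τs := by rwa [div_lt_iff₀ hpos]
      obtain ⟨n, hn⟩ := (hlim.eventually (eventually_gt_nhds hlt)).exists
      exact ⟨n, by rwa [div_lt_iff₀ hpos] at hn⟩
  exact measure_mono_null hsub (measure_iUnion_null fun n => h n)

/-- **Initial aperture + the step below slope `1` ⇒ the light cone (PROVED).** -/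
theorem planarConeSupport_of_step (hinit : PlanarInitialAperture) (hstep : PlanarApertureStep) : PlanarConeSupport := by
  intro k μ hk hμ
  obtain ⟨c, hc, hcμ⟩ := hinit k hk
  have h0 : HasAperture μ (min c 1) := hasAperture_mono (hcμ μ hμ) (min_le_left _ _)
  set T : Set ℝ := {σ : ℝ | σ ≤ 1 ∧ HasAperture μ σ} with hT
  have hTne : T.Nonempty := ⟨min c 1, min_le_right _ _, h0⟩
  have hTbdd : BddAbove T := ⟨1, fun σ hσ => hσ.1⟩
  have hmem : min c 1 ∈ T := ⟨min_le_right _ _, h0⟩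
  obtain ⟨u, _, hulim, huT⟩ := exists_seq_tendsto_sSup hTne hTbdd
  have hsup : HasAperture μ (sSup T) := hasAperture_of_tendsto (fun n => (huT n).2) hulim
  have hsup_le : sSup T ≤ 1 := csSup_le hTne fun σ hσ => hσ.1
  have hsup_pos : 0 < sSup T := lt_of_lt_of_le (lt_min hc one_pos) (le_csSup hTbdd hmem)
  by_cases h1 : sSup T < 1
  · exfalso
    obtain ⟨τ', hτ', hstep'⟩ := hstep (sSup T) hsup_pos h1
    have hmem' : min τ' 1 ∈ T := ⟨min_le_right _ _, hasAperture_mono (hstep' k μ hk hμ hsup) (min_le_left _ _)⟩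
    have : min τ' 1 ≤ sSup T := le_csSup hTbdd hmem'
    have h2 : sSup T < min τ' 1 := lt_min hτ' h1
    linarith
  · have heq : sSup T = 1 := le_antisymm hsup_le (not_lt.mp h1)
    simpa [heq] using hsup

/-- (C) for every planar class kernel, from the four pieces. [problem-side composition] -/
theorem planarSpectralCone_of_pieces (hFD : FlatDoubleEdge) (hinit : PlanarInitialAperture)
    (hstep : FlatDoubleEdge → PlanarApertureStep)
    (hpack : PlanarConeSupport → ∀ k : E2 → ℝ, InPlanarClass k → PlanarSpectralCone k) :
    ∀ k : E2 → ℝ, InPlanarClass k → PlanarSpectralCone k :=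
  hpack (planarConeSupport_of_step hinit (hstep hFD))

/-! ## Composition down to the crux -/

theorem mk2_eta (y : E2) : mk2 (y 0) (y 1) = y := by
  ext i; fin_cases i <;> simp [mk2]

theorem norm_sq_eq (y : E2) : ‖y‖ ^ 2 = y 0 ^ 2 + y 1 ^ 2 := by
  rw [EuclideanSpace.real_norm_sq_eq, Fin.sum_univ_two]

/-- Polar form of a non-zero planar vector. [bookkeeping] -/
theorem exists_polar {y : E2} (hy : y ≠ 0) : ∃ φ : ℝ, y = polar ‖y‖ φ := by
  have hr : 0 < ‖y‖ := norm_pos_iff.mpr hy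
  set w : ℂ := ⟨y 0, y 1⟩ with hw
  have hnorm : ‖w‖ = ‖y‖ := by
    rw [Complex.norm_def, Complex.normSq_mk, ← sq, ← sq, ← norm_sq_eq]
    exact Real.sqrt_sq hr.le
  have hw0 : w ≠ 0 := by
    intro h0; rw [h0, norm_zero] at hnorm; linarith
  refine ⟨Complex.arg w, ?_⟩
  have hc : y 0 = ‖y‖ * Real.cos (Complex.arg w) := by
    have := Complex.cos_arg hw0
    rw [hnorm] at this
    field_simp at this
    simpa [hw, mul_comm] using this.symm
  have hs : y 1 = ‖y‖ * Real.sin (Complex.arg w) := by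
    have := Complex.sin_arg w
    rw [hnorm] at this
    field_simp at this
    simpa [hw, mul_comm] using this.symm
  rw [polar, ← hc, ← hs, mk2_eta]

/-- The angular-type assembly with the LANDED (A) and (P): (C) for all planar class kernels ⇒ planar rigidity. [problem-side composition] -/
theorem planarRigidity_of_cone (hcone : ∀ k : E2 → ℝ, InPlanarClass k → PlanarSpectralCone k) : PlanarRigidity := by
  intro k hk R y hy
  have hr : 0 < ‖y‖ := norm_pos_iff.mpr hy
  have hRy : R y ≠ 0 := fun h => hy (by simpa using congrArg R.symm h)
  obtain ⟨φ, hφ⟩ := exists_polar hy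
  obtain ⟨φ', hφ'⟩ := exists_polar hRy
  rw [LinearIsometryEquiv.norm_map] at hφ'
  obtain ⟨G, hG, hGk, hGper, hGgrowth⟩ := stub_angularContinuation k hk (hcone k hk) ‖y‖ hr
  have hconst : G (φ' : ℂ) = G (φ : ℂ) := stub_periodicEntireRigidity G hG hGper hGgrowth φ' φ
  rw [hGk, hGk] at hconst
  calc k (R y) = k (polar ‖y‖ φ') := by rw [hφ']
    _ = k (polar ‖y‖ φ) := by exact_mod_cast hconst
    _ = k y := by rw [← hφ]

/-- The pieces as hypotheses (for by-name landings in any order). [problem-side composition] -/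
theorem shortRootRigidity_of_pieces (hFD : FlatDoubleEdge) (hinit : PlanarInitialAperture)
    (hstep : FlatDoubleEdge → PlanarApertureStep)
    (hpack : PlanarConeSupport → ∀ k : E2 → ℝ, InPlanarClass k → PlanarSpectralCone k) (hodd : OddModeRigidity) :
    ShortRootRigidity :=
  Summit.QuantumFields.YangMills.Theorems.F4SubCurvatureDoorGlobalReduction.shortRootRigidity_of_global
    (fun K hK hbd hB hRP hbud hlat =>
      hodd K ⟨hK, hbd, hB, hRP, hbud, hlat⟩
        (stub_sliceDensity K ⟨hK, hbd, hB, hRP, hbud, hlat⟩ (fun a R y hy =>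
          planarRigidity_of_cone (planarSpectralCone_of_pieces hFD hinit hstep hpack)
            (slice K a) (stub_sliceInClass K ⟨hK, hbd, hB, hRP, hbud, hlat⟩ a) R y hy)))

/-- **Composition (kernel-checked): the registered stubs imply the route crux `ShortRootRigidity` BY NAME** — through the PROVED bootstrap,
the landed (A), (P), `stub_sliceInClass` ✓, `stub_sliceDensity` ✓ and the tree certificate `shortRootRigidity_of_global`.  The only
hypothesis-free theorem of this file concluding the crux. [problem-side composition] -/
theorem ShortRootRigidity_of_bootstrap : ShortRootRigidity :=
  shortRootRigidity_of_pieces stub_flatDoubleEdge stub_planarInitialAperture stub_planarApertureStep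
    stub_planarSpectralCone_of_coneSupport stub_oddModeRigidity

end Summit.QuantumFields.YangMills.Cruxes.ShortRootRigidity.ApertureBootstrap

end
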